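import Literature.MathematicalPhysics.QuantumFieldTheory.Balaban1983to89.B9Eq326ConjugatedDeltaALetters
import Literature.MathematicalPhysics.QuantumFieldTheory.Balaban1983to89.B9Eq3101ConjugationLettersCurl
import Literature.MathematicalPhysics.QuantumFieldTheory.Balaban1983to89.B9Eq3101ConjugationLettersCoCurl
import Literature.MathematicalPhysics.QuantumFieldTheory.Balaban1983to89.B9Eq326OperatorTower

/-!
# `Balaban1983to89.B9Eq326ConjugatedDeltaATower` — T. Bałaban, *Propagators for lattice gauge theories in a background field*, Commun. Math. Phys. **99**
# (1985) 389–434 [Balaban1985BackgroundPropagators] (3.26) p. 395 (with (3.16)∕(3.24) p. 393–394: the `k`-level operators), (3.21)∕(3.25) p. 394, (3.10)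
# p. 392, (3.49) p. 399, Thm 3.11 p. 416 with [Balaban1985Variational] (110) p. 294: **THE CONJUGATED `k`-LEVEL BOND PROPAGATOR —
# `‖e^{κχ}·G₁,k(U)·e^{−κχ}‖ ≤ 4∕γ` FOR `G₁,k(U) = Δ_{a,k}(U)⁻¹`, `Δ_{a,k}(U) = Δ(U) + D_UR_k(U)D*_U + Q_k†(a•Q_k)` ON `towerP L m (n+1)`**
# (`B9Eq326OperatorTower.laplaceAk` ∕ `RofUk` ∕ `G1k`, the composite averaging `QkW`) — the TOWER PORT of this lineage's one-step
# `B9Eq326ConjugatedDeltaA` (same proof text, `towerP L m (n + 1) ↦ towerP L m (n+1)`, `laplaceAofU ↦ laplaceAk`, `RofU ↦ RofUk`, `G1ofU ↦ G1k`; the curl ∕ cocurl ∕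
# divergence ∕ gradient conjugation letters of `B9Eq3101ConjugationLettersCurl` ∕ `…CoCurl` ∕ `…Chain` are stated for every periodic lattice and apply at the
# tower verbatim — NO per-level transport factor); letters `γ` (Thm 3.11 at `k` levels), `p_K`, `β_K`, the `Q_k` letters, `ρ` (conjugated `R_k(U)`), `C_P`
# displayed — every height `n`

statement-level skeleton of published theorems with citation tags; proofs where landed; nothing here is a claim about the Yang–Mills mass gap

CITATION HEADER (lean-in-tree rule).  Audit cell `pub-balaban`, sub-cell `t4`, BINDER row NE9; filed by NE9 formalisation-swarm leaf prover 03
(`b2b-balaban-t4-ne9-formalise-leaf-03`, gen 75).  Imports this lineage's `B9Eq326ConjugatedDeltaALetters`, the NE9 owner's `B9Eq3101ConjugationLettersCurl` ∕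
`…CoCurl`, and `B9Eq326OperatorTower` (`laplaceAk`, `RofUk`, `G1k`, `QkW`).  Proof text = the one-step file's (CREDIT for the pattern: t4-ne9-p1 g92's
(D0-c)).  Sources READ first-hand: [Balaban1985BackgroundPropagators] p. 395 (3.26), p. 393–394 (3.16)∕(3.24), p. 394 (3.21)∕(3.25), p. 392 (3.10), p. 399
(3.49), p. 416 Thm 3.11; [Balaban1985Variational] p. 294 (110).  Print's decay proof is the random walk of Sect. C; the conjugation is the ROUTE's
Combes–Thomas substitute; nothing of print's rate is asserted.

WHAT IS PROVED (sorry-free; proof lane — no `def`; [folklore] composition BY NAME).  As `B9Eq326ConjugatedDeltaA`, at `n+1` levels: §0 `apply_inv_apply'`,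
`apply_apply_inv'`, `conj_inv_eta'`, `RofUk_RofUk`, `re_inner_RofUk_eq`, `norm_RofUk_le`, **`deltaAk_structure`**, **`conjDeltaAk_apply`**, `conjDeltaAk_conjInv`;
§1 **`norm_conjG1k_le`** — `‖(S ∘ G₁,k(U) ∘ S⁻¹)v‖ ≤ (4∕γ)‖v‖`, every height `n`.
HONEST SCOPE.  Composition; `γ`, `p_K`, `β_K`, the `Q_k` letters, `ρ`, `C_P` displayed (their `k`-level suppliers are the next bricks: the tower twins of
`B9Eq325ProjectionDivergenceEnergyBound` and `B9Eq349ConjugatedProjectionDifferenceChain` over `B9Eq349ConjugatedProjectionChainTower`); nothing of [B9] Thm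
3.1∕3.3∕3.11 asserted, valued or discharged; «NE9 ⇐ the named binders»; NE9 NOT PRINTED ∕ NOT PROVED; row WALLED ON A MODEL (O-NE9-1; #5 UNRULED); spine PROVED
0∕9; rung (B)+1 on a finite T⁴ — NOT infinite volume, NOT mass gap, NOT BetaPertH, NOT Clay.  HONEST DEPENDENCY: continuum YM on T⁴ ⇐ BetaPertH ∧ nine spine
estimates (0/9 proved); BetaPertH ⇐ (D1) ∧ (D4) ∧ CAP+tail.  NEW file; nothing modified.  Net new unproved facts: 0.
-/

noncomputable section

open scoped InnerProductSpace ComplexConjugate BigOperators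

namespace Literature.MathematicalPhysics.QuantumFieldTheory.Balaban1983to89.B9Eq326ConjugatedDeltaATower

open B4Sect5Torus (TSite)
open B9SectCLatticeCarrier (Bond bpos btgt)
open B9Eq311L2Pairing (WL2)
open B7Prop1Explicit (U1)
open B9Eq315QTower (towerP)
open B9Eq315QTorus (perCfg cornerSite)
open B7Prop1Explicit (Wcx boxVec)
open B11Eq103H1Complex (SiteL2K BondL2K greenK apply_greenK covDerivL2K covDivL2K adjoint_covDerivL2K laplaceAK projR projR_projR)
open B9Eq310HessianOperator (adTransportW PlaqL2K covCurlL2K covCoCurlL2K principalOpK curvOp hessOp principalOpK_eq_comp adjoint_covCurlL2K)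
open B9Eq3101ConjugationLettersChain (norm_adTransportW_le norm_mulOp_covDerivL2K_adTransportW_sub_le)
open B9Eq3101ConjugationLettersCurl (norm_mulOp_covCurlL2K_sub_le norm_mulOp_covDivL2K_sub_le)
open B9Eq3101ConjugationLettersCoCurl (norm_mulOp_covCoCurlL2K_sub_le)
open B9Eq326OperatorTower (laplaceAk RofUk RofUk_isSymmetric G1k QkW)
open B9Eq326ConjugatedDeltaALetters (norm_Gk_le_projected)

/-! ## §0 Pointwise multipliers: bookkeeping -/

section Multipliers

variable {X : Type*} {V : Type*} [NormedAddCommGroup V] [InnerProductSpace ℂ V] {w : X → ℝ}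

/-- Two maps acting pointwise as `e^{−κχ}` and `e^{κχ}` compose to the identity. [folklore] [cite: Balaban1985BackgroundPropagators, (3.49) p.399] -/
theorem apply_inv_apply' (κ : ℂ) (χ : X → ℝ) {T Tinv : WL2 ℂ w V → WL2 ℂ w V}
    (hT : ∀ g x, WL2.equiv ℂ w V (T g) x = Complex.exp (κ * (χ x : ℂ)) • WL2.equiv ℂ w V g x)
    (hTinv : ∀ g x, WL2.equiv ℂ w V (Tinv g) x = Complex.exp (-(κ * (χ x : ℂ))) • WL2.equiv ℂ w V g x) (g : WL2 ℂ w V) :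
    Tinv (T g) = g := by
  apply (WL2.equiv ℂ w V).injective
  funext x
  rw [hTinv, hT, smul_smul, ← Complex.exp_add, neg_add_cancel, Complex.exp_zero, one_smul]

/-- … and in the other order. [folklore] [cite: Balaban1985BackgroundPropagators, (3.49) p.399] -/
theorem apply_apply_inv' (κ : ℂ) (χ : X → ℝ) {T Tinv : WL2 ℂ w V → WL2 ℂ w V}
    (hT : ∀ g x, WL2.equiv ℂ w V (T g) x = Complex.exp (κ * (χ x : ℂ)) • WL2.equiv ℂ w V g x)
    (hTinv : ∀ g x, WL2.equiv ℂ w V (Tinv g) x = Complex.exp (-(κ * (χ x : ℂ))) • WL2.equiv ℂ w V g x) (g : WL2 ℂ w V) :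
    T (Tinv g) = g := by
  apply (WL2.equiv ℂ w V).injective
  funext x
  rw [hT, hTinv, smul_smul, ← Complex.exp_add, add_neg_cancel, Complex.exp_zero, one_smul]

end Multipliers

/-! ## §0′ `R(U)` is an orthogonal projection; the structure of `Δ_a` and of its conjugate -/

section Instance

variable {d : ℕ} (L : ℕ) [NeZero L] (m : Fin d → ℕ) [∀ i, NeZero (m i)] (n : ℕ)
  {𝔸 : Type*} [NormedRing 𝔸] [StarRing 𝔸] [NormedAlgebra ℂ 𝔸] [StarModule ℂ 𝔸] [CompleteSpace 𝔸] [NormOneClass 𝔸]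
  {W : Type*} [NormedAddCommGroup W] [InnerProductSpace ℂ W] [FiniteDimensional ℂ W] (φ : W ≃ₗ[ℂ] 𝔸) {Mφ Mφ' : ℝ}
  (hφ : ∀ w, ‖φ w‖ ≤ Mφ * ‖w‖) (hφ' : ∀ X, ‖φ.symm X‖ ≤ Mφ' * ‖X‖) (hMφ : 0 ≤ Mφ) (hMφ' : 0 ≤ Mφ')
  {c₀ : ℝ} [Fact (0 < c₀)] {c₁ : ℝ} [Fact (0 < c₁)] {η : ℝ} (hη : 0 < η) (U : Bond d (towerP L m (n + 1)) → 𝔸ˣ) (hU : ∀ b, U b ∈ U1 𝔸)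
  (hRS : ∀ (b : Bond d (towerP L m (n + 1))) (v u : W), ⟪adTransportW φ U b v, u⟫_ℂ = ⟪v, adTransportW φ (fun b => (U b)⁻¹) b u⟫_ℂ)
  (τ : 𝔸 →ₗ[ℂ] ℂ) (hL : 1 ≤ L) (α : ℕ → ℝ) (hα1 : ∀ j, α j ≤ 1 / 64)
  (hU1 : ∀ (j : ℕ) (x : B7Prop1Explicit.Site d) (κ : Fin d), perCfg (towerP L m (j + 1)) (B9Eq315QTower.UlevOf L m (n + 1) U j) x κ ∈ U1 𝔸)
  (hreg : ∀ (j : ℕ) (y : TSite d (towerP L m j)) (κ : Fin d) (r : Fin d → Fin L),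
    ‖((Wcx L (perCfg (towerP L m (j + 1)) (B9Eq315QTower.UlevOf L m (n + 1) U j)) (cornerSite L y) κ (boxVec L r) : 𝔸ˣ) : 𝔸) - 1‖ ≤ α j)
  (a : ℝ)

/-- `conj η⁻¹ = η⁻¹` for the real difference quotient. [folklore] [cite: Balaban1985BackgroundPropagators, (3.3) p.391] -/
theorem conj_inv_eta' (η : ℝ) : (starRingEnd ℂ) ((η : ℂ))⁻¹ = ((η : ℂ))⁻¹ := by rw [map_inv₀, Complex.conj_ofReal]

omit [StarRing 𝔸] [StarModule ℂ 𝔸] [NormOneClass 𝔸] in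
/-- `R(U)² = R(U)` (`B11Eq103H1Complex.projR_projR`). [cite: Balaban1985BackgroundPropagators, (3.21) p.394] -/
theorem RofUk_RofUk (s : SiteL2K ℂ d (towerP L m (n + 1)) c₀ W) :
    RofUk L m n φ η U (c₀ := c₀) (RofUk L m n φ η U (c₀ := c₀) s) = RofUk L m n φ η U (c₀ := c₀) s := by
  unfold RofUk B11Eq103H1Complex.RLatticeK
  exact projR_projR _ _ s

omit [StarRing 𝔸] [StarModule ℂ 𝔸] [NormOneClass 𝔸] in
/-- **`re⟪s, R(U)s⟫ = ‖R(U)s‖²`** — `R(U)` is a symmetric idempotent. [cite: Balaban1985BackgroundPropagators, (3.21) p.394] -/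
theorem re_inner_RofUk_eq (s : SiteL2K ℂ d (towerP L m (n + 1)) c₀ W) :
    RCLike.re ⟪s, RofUk L m n φ η U (c₀ := c₀) s⟫_ℂ = ‖RofUk L m n φ η U (c₀ := c₀) s‖ ^ 2 := by
  conv_lhs => rw [← RofUk_RofUk L m n φ U s, ← RofUk_isSymmetric L m n φ η U (c₀ := c₀) s]
  exact inner_self_eq_norm_sq (𝕜 := ℂ) _

omit [StarRing 𝔸] [StarModule ℂ 𝔸] [NormOneClass 𝔸] in
/-- **`‖R(U)s‖ ≤ ‖s‖`.** [cite: Balaban1985BackgroundPropagators, (3.21) p.394] -/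
theorem norm_RofUk_le (s : SiteL2K ℂ d (towerP L m (n + 1)) c₀ W) : ‖RofUk L m n φ η U (c₀ := c₀) s‖ ≤ ‖s‖ := by
  have h := re_inner_RofUk_eq L m n φ (η := η) U s
  have h2 : RCLike.re ⟪s, RofUk L m n φ η U (c₀ := c₀) s⟫_ℂ ≤ ‖s‖ * ‖RofUk L m n φ η U (c₀ := c₀) s‖ :=
    (RCLike.re_le_norm _).trans (norm_inner_le_norm _ _)
  by_cases hx : RofUk L m n φ η U (c₀ := c₀) s = 0
  · rw [hx, norm_zero]; exact norm_nonneg _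
  · have hxpos : 0 < ‖RofUk L m n φ η U (c₀ := c₀) s‖ := norm_pos_iff.mpr hx
    nlinarith [h, h2, hxpos]

include hRS in
/-- **`Δ_a(U)` IN THE SHAPE `B₁†B₁ + B₂†RB₂ + K + aQ_k†Q_k`** of `B9Eq326ConjugatedDeltaALetters`: with `B₁ = covCurlL2K` (curl (3.4), transporters `R(U)`),
`B₂ = covDivL2K` (divergence (3.8), transporters `R(U⁻¹)`; `B₂† = D_U` by `adjoint_covDerivL2K`), `R = R(U)` ((3.21)), `K = Δ′ = curvOp`:
`Δ_af = B₁†(B₁f) + B₂†(R(B₂f)) + Δ′f + a•Q_k†(Qf)`. [cite: Balaban1985BackgroundPropagators, (3.26) p.395, (3.10) p.392, (3.21) p.394] -/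
theorem deltaAk_structure (f : BondL2K ℂ d (towerP L m (n + 1)) c₀ W) :
    laplaceAk L m n φ η U hL α hα1 hU1 hreg τ (c₀ := c₀) (c₁ := c₁) a f =
      LinearMap.adjoint (covCurlL2K ℂ c₀ ((η : ℂ))⁻¹ (adTransportW φ U)) (covCurlL2K ℂ c₀ ((η : ℂ))⁻¹ (adTransportW φ U) f) +
      LinearMap.adjoint (covDivL2K ℂ c₀ ((η : ℂ))⁻¹ (adTransportW φ fun b => (U b)⁻¹))
        (RofUk L m n φ η U (c₀ := c₀) (covDivL2K ℂ c₀ ((η : ℂ))⁻¹ (adTransportW φ fun b => (U b)⁻¹) f)) +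
      curvOp φ τ η U f + ((a : ℝ) : ℂ) • LinearMap.adjoint (QkW L m n φ U hL α hα1 hU1 hreg (c₀ := c₀) (c₁ := c₁)) ((QkW L m n φ U hL α hα1 hU1 hreg (c₀ := c₀) (c₁ := c₁)) f) := by
  have h1 : LinearMap.adjoint (covCurlL2K ℂ c₀ ((η : ℂ))⁻¹ (adTransportW φ U)) =
      covCoCurlL2K ℂ c₀ ((η : ℂ))⁻¹ (adTransportW φ fun b => (U b)⁻¹) := adjoint_covCurlL2K _ (conj_inv_eta' η) _ _ hRS
  have h2 : LinearMap.adjoint (covDivL2K ℂ c₀ ((η : ℂ))⁻¹ (adTransportW φ fun b => (U b)⁻¹)) =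
      covDerivL2K ℂ c₀ ((η : ℂ))⁻¹ (adTransportW φ U) := by
    rw [← adjoint_covDerivL2K ((η : ℂ))⁻¹ (conj_inv_eta' η) _ _ hRS, LinearMap.adjoint_adjoint]
  rw [h1, h2]
  unfold laplaceAk B11Eq103H1Complex.laplaceALatticeK
  rw [laplaceAK, hessOp, principalOpK_eq_comp]
  simp only [LinearMap.add_apply, LinearMap.comp_apply, LinearMap.smul_apply, map_smul]
  abel

variable {κ : ℂ} {χ : TSite d (towerP L m (n + 1)) → ℝ}
  {S Sinv : BondL2K ℂ d (towerP L m (n + 1)) c₀ W →ₗ[ℂ] BondL2K ℂ d (towerP L m (n + 1)) c₀ W}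
  (hS : ∀ (g : BondL2K ℂ d (towerP L m (n + 1)) c₀ W) (b : Bond d (towerP L m (n + 1))),
    WL2.equiv ℂ (fun _ : Bond d (towerP L m (n + 1)) => c₀) W (S g) b =
      Complex.exp (κ * (χ (bpos b) : ℂ)) • WL2.equiv ℂ (fun _ : Bond d (towerP L m (n + 1)) => c₀) W g b)
  (hSinv : ∀ (g : BondL2K ℂ d (towerP L m (n + 1)) c₀ W) (b : Bond d (towerP L m (n + 1))),
    WL2.equiv ℂ (fun _ : Bond d (towerP L m (n + 1)) => c₀) W (Sinv g) b =
      Complex.exp (-(κ * (χ (bpos b) : ℂ))) • WL2.equiv ℂ (fun _ : Bond d (towerP L m (n + 1)) => c₀) W g b)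
  {SP SPinv : PlaqL2K ℂ d (towerP L m (n + 1)) c₀ W →ₗ[ℂ] PlaqL2K ℂ d (towerP L m (n + 1)) c₀ W}
  (hSP : ∀ (g : PlaqL2K ℂ d (towerP L m (n + 1)) c₀ W) (p : B9SectCLatticeCarrier.Plaq d (towerP L m (n + 1))),
    WL2.equiv ℂ (fun _ : B9SectCLatticeCarrier.Plaq d (towerP L m (n + 1)) => c₀) W (SP g) p =
      Complex.exp (κ * (χ p.1 : ℂ)) • WL2.equiv ℂ (fun _ : B9SectCLatticeCarrier.Plaq d (towerP L m (n + 1)) => c₀) W g p)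
  (hSPinv : ∀ (g : PlaqL2K ℂ d (towerP L m (n + 1)) c₀ W) (p : B9SectCLatticeCarrier.Plaq d (towerP L m (n + 1))),
    WL2.equiv ℂ (fun _ : B9SectCLatticeCarrier.Plaq d (towerP L m (n + 1)) => c₀) W (SPinv g) p =
      Complex.exp (-(κ * (χ p.1 : ℂ))) • WL2.equiv ℂ (fun _ : B9SectCLatticeCarrier.Plaq d (towerP L m (n + 1)) => c₀) W g p)
  {SS SSinv : SiteL2K ℂ d (towerP L m (n + 1)) c₀ W →ₗ[ℂ] SiteL2K ℂ d (towerP L m (n + 1)) c₀ W}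
  (hSS : ∀ (g : SiteL2K ℂ d (towerP L m (n + 1)) c₀ W) (x : TSite d (towerP L m (n + 1))),
    WL2.equiv ℂ (fun _ : TSite d (towerP L m (n + 1)) => c₀) W (SS g) x =
      Complex.exp (κ * (χ x : ℂ)) • WL2.equiv ℂ (fun _ : TSite d (towerP L m (n + 1)) => c₀) W g x)
  (hSSinv : ∀ (g : SiteL2K ℂ d (towerP L m (n + 1)) c₀ W) (x : TSite d (towerP L m (n + 1))),
    WL2.equiv ℂ (fun _ : TSite d (towerP L m (n + 1)) => c₀) W (SSinv g) x =
      Complex.exp (-(κ * (χ x : ℂ))) • WL2.equiv ℂ (fun _ : TSite d (towerP L m (n + 1)) => c₀) W g x)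

include hRS hSP hSPinv hSS hSSinv in
/-- **THE CONJUGATED `Δ_a` HAS THE CONJUGATED STRUCTURE**: with `B_{1,κ} = S_P∘curl∘S⁻¹`, `B′_{1,κ} = S∘cocurl∘S_P⁻¹`, `B_{2,κ} = S_S∘D*∘S⁻¹`, `R_κ = S_S∘R(U)∘S_S⁻¹`,
`B′_{2,κ} = S∘D∘S_S⁻¹`, `K_κ = S∘Δ′∘S⁻¹` and any factorisation `S(Q_k†(a•Q_k(S⁻¹f))) = a•Q_k′_κ(Q_κf)`:
`(S∘Δ_a∘S⁻¹)f = B′_{1,κ}(B_{1,κ}f) + B′_{2,κ}(R_κ(B_{2,κ}f)) + K_κf + a•Q_k′_κ(Q_κf)` (insert `S_P⁻¹S_P = 1`, `S_S⁻¹S_S = 1` twice).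
[cite: Balaban1985BackgroundPropagators, (3.26) p.395, (3.49) p.399] -/
theorem conjDeltaAk_apply (Qk : BondL2K ℂ d (towerP L m (n + 1)) c₀ W →ₗ[ℂ] BondL2K ℂ d m c₁ W) (Qk' : BondL2K ℂ d m c₁ W →ₗ[ℂ] BondL2K ℂ d (towerP L m (n + 1)) c₀ W)
    (hQfac : ∀ f, S (LinearMap.adjoint (QkW L m n φ U hL α hα1 hU1 hreg (c₀ := c₀) (c₁ := c₁)) (((a : ℝ) : ℂ) • (QkW L m n φ U hL α hα1 hU1 hreg (c₀ := c₀) (c₁ := c₁)) (Sinv f))) = ((a : ℝ) : ℂ) • Qk' (Qk f)) (f : BondL2K ℂ d (towerP L m (n + 1)) c₀ W) :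
    (S ∘ₗ laplaceAk L m n φ η U hL α hα1 hU1 hreg τ (c₀ := c₀) (c₁ := c₁) a ∘ₗ Sinv) f =
      (S ∘ₗ covCoCurlL2K ℂ c₀ ((η : ℂ))⁻¹ (adTransportW φ fun b => (U b)⁻¹) ∘ₗ SPinv)
          ((SP ∘ₗ covCurlL2K ℂ c₀ ((η : ℂ))⁻¹ (adTransportW φ U) ∘ₗ Sinv) f) +
        (S ∘ₗ covDerivL2K ℂ c₀ ((η : ℂ))⁻¹ (adTransportW φ U) ∘ₗ SSinv)
          ((SS ∘ₗ RofUk L m n φ η U (c₀ := c₀) ∘ₗ SSinv) ((SS ∘ₗ covDivL2K ℂ c₀ ((η : ℂ))⁻¹ (adTransportW φ fun b => (U b)⁻¹) ∘ₗ Sinv) f)) +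
        (S ∘ₗ curvOp φ τ η U ∘ₗ Sinv) f + ((a : ℝ) : ℂ) • Qk' (Qk f) := by
  have hP : ∀ g, SPinv (SP g) = g := apply_inv_apply' κ (fun p : B9SectCLatticeCarrier.Plaq d (towerP L m (n + 1)) => χ p.1) hSP hSPinv
  have hSi : ∀ g, SSinv (SS g) = g := apply_inv_apply' κ χ hSS hSSinv
  have h1 : LinearMap.adjoint (covCurlL2K ℂ c₀ ((η : ℂ))⁻¹ (adTransportW φ U)) =
      covCoCurlL2K ℂ c₀ ((η : ℂ))⁻¹ (adTransportW φ fun b => (U b)⁻¹) := adjoint_covCurlL2K _ (conj_inv_eta' η) _ _ hRS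
  have h2 : LinearMap.adjoint (covDivL2K ℂ c₀ ((η : ℂ))⁻¹ (adTransportW φ fun b => (U b)⁻¹)) =
      covDerivL2K ℂ c₀ ((η : ℂ))⁻¹ (adTransportW φ U) := by
    rw [← adjoint_covDerivL2K ((η : ℂ))⁻¹ (conj_inv_eta' η) _ _ hRS, LinearMap.adjoint_adjoint]
  simp only [LinearMap.comp_apply, hP, hSi]
  rw [deltaAk_structure L m n φ (η := η) U hRS τ hL α hα1 hU1 hreg a (Sinv f), h1, h2, ← hQfac]
  simp only [map_add, map_smul]

include hS hSinv in
/-- **`(S∘Δ_a∘S⁻¹)(S∘G₁∘S⁻¹) = 1`** (`S⁻¹S = 1`, `SS⁻¹ = 1`, `Δ_aG₁ = 1`). [cite: Balaban1985BackgroundPropagators, (3.26) p.395, Thm 3.11 p.416; Balaban1985Variational, (110) p.294] -/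
theorem conjDeltaAk_conjInv
    (hpos : ∀ x : BondL2K ℂ d (towerP L m (n + 1)) c₀ W, x ≠ 0 → 0 < RCLike.re ⟪x, laplaceAk L m n φ η U hL α hα1 hU1 hreg τ (c₀ := c₀) (c₁ := c₁) a x⟫_ℂ)
    (v : BondL2K ℂ d (towerP L m (n + 1)) c₀ W) :
    (S ∘ₗ laplaceAk L m n φ η U hL α hα1 hU1 hreg τ (c₀ := c₀) (c₁ := c₁) a ∘ₗ Sinv) ((S ∘ₗ G1k L m n φ η U hL α hα1 hU1 hreg τ (c₀ := c₀) (c₁ := c₁) hpos ∘ₗ Sinv) v) = v := by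
  simp only [LinearMap.comp_apply]
  rw [apply_inv_apply' κ (fun b : Bond d (towerP L m (n + 1)) => χ (bpos b)) hS hSinv]
  unfold G1k B11Eq103H1Complex.G1LatticeK B11Eq103H1Complex.G1K laplaceAk B11Eq103H1Complex.laplaceALatticeK
  rw [apply_greenK, apply_apply_inv' κ (fun b : Bond d (towerP L m (n + 1)) => χ (bpos b)) hS hSinv]

/-! ## §1 `‖S G₁(U) S⁻¹‖ ≤ 4∕γ` -/

include hφ hφ' hMφ hMφ' hη hU hRS hS hSinv hSP hSPinv hSS hSSinv in
/-- **THE CONJUGATED BOND PROPAGATOR IS BOUNDED: `‖(S∘G₁(U)∘S⁻¹)v‖ ≤ (4∕γ)‖v‖`.**  `B9Eq326ConjugatedDeltaALetters.norm_Gk_le_projected` at the chain's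
`Δ_a(U) = Δ(U) + D_UR(U)D*_U + Q_k†(a•Q_k)` with: `γ`-coercivity of `Δ_a` (Thm 3.11; displayed), the `Δ′` floor `re⟪f, Δ′f⟫ ≥ −p_K‖f‖²` (displayed), the curl ∕
cocurl ∕ divergence ∕ gradient conjugation letters DISCHARGED (`B9Eq3101ConjugationLettersCurl` ∕ `…CoCurl` ∕ `…Chain` with `M_T = M_φM_φ′` for bond variables
in the unit balls) in the windows `‖κ‖ℓη ≤ 1`, `4‖κ‖ℓM_φM_φ′d√d ≤ β`, `4‖κ‖ℓM_φM_φ′d ≤ β`, `2‖κ‖ℓM_φM_φ′√d ≤ β`, the conjugated `Q_k` and `Δ′` letters displayed,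
the conjugated-projection letter `‖S_SR(U)S_S⁻¹ − R(U)‖ ≤ ρ ≤ 1∕8` and the complementary-projection letter `‖(1 − R(U))D*_U‖ ≤ C_P` displayed, and the window
`p_K∕2 + (21 + 3a)β² + 4βC_P + 2ρC_P² + β_K ≤ γ∕4` — every `U`, `χ`, `κ` of the letters, NO `η`, NO volume.
[cite: Balaban1985BackgroundPropagators, (3.26) p.395, (3.21) p.394, (3.49) p.399, Thm 3.11 p.416; Balaban1985Variational, (110) p.294] -/
theorem norm_conjG1k_le (ha : 0 ≤ a)
    (hpos : ∀ x : BondL2K ℂ d (towerP L m (n + 1)) c₀ W, x ≠ 0 → 0 < RCLike.re ⟪x, laplaceAk L m n φ η U hL α hα1 hU1 hreg τ (c₀ := c₀) (c₁ := c₁) a x⟫_ℂ)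
    {γ β βK pK ℓ ρ CP : ℝ} (hγ : 0 < γ) (hβ : 0 ≤ β) (hℓ : 0 ≤ ℓ) (hρ : 0 ≤ ρ) (hρ8 : ρ ≤ 1 / 8) (hCP : 0 ≤ CP)
    (hcoer : ∀ f : BondL2K ℂ d (towerP L m (n + 1)) c₀ W, γ * ‖f‖ ^ 2 ≤ RCLike.re ⟪f, laplaceAk L m n φ η U hL α hα1 hU1 hreg τ (c₀ := c₀) (c₁ := c₁) a f⟫_ℂ)
    (hKre : ∀ f : BondL2K ℂ d (towerP L m (n + 1)) c₀ W, -(pK * ‖f‖ ^ 2) ≤ RCLike.re ⟪f, curvOp φ τ η U f⟫_ℂ)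
    (hχ : ∀ b : Bond d (towerP L m (n + 1)), |χ (bpos b) - χ (btgt b)| ≤ ℓ * η) (hwin : ‖κ‖ * ℓ * η ≤ 1)
    (hβCC : 4 * ‖κ‖ * ℓ * (Mφ * Mφ') * (d * Real.sqrt d) ≤ β) (hβC : 4 * ‖κ‖ * ℓ * (Mφ * Mφ') * d ≤ β)
    (hβD : 2 * ‖κ‖ * ℓ * (Mφ * Mφ') * Real.sqrt d ≤ β)
    (Qk : BondL2K ℂ d (towerP L m (n + 1)) c₀ W →ₗ[ℂ] BondL2K ℂ d m c₁ W) (Qk' : BondL2K ℂ d m c₁ W →ₗ[ℂ] BondL2K ℂ d (towerP L m (n + 1)) c₀ W)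
    (hQfac : ∀ f, S (LinearMap.adjoint (QkW L m n φ U hL α hα1 hU1 hreg (c₀ := c₀) (c₁ := c₁)) (((a : ℝ) : ℂ) • (QkW L m n φ U hL α hα1 hU1 hreg (c₀ := c₀) (c₁ := c₁)) (Sinv f))) = ((a : ℝ) : ℂ) • Qk' (Qk f))
    (dQ : ∀ f, ‖Qk f - (QkW L m n φ U hL α hα1 hU1 hreg (c₀ := c₀) (c₁ := c₁)) f‖ ≤ β * ‖f‖) (dQ' : ∀ g, ‖Qk' g - LinearMap.adjoint (QkW L m n φ U hL α hα1 hU1 hreg (c₀ := c₀) (c₁ := c₁)) g‖ ≤ β * ‖g‖)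
    (dK : ∀ f, ‖(S ∘ₗ curvOp φ τ η U ∘ₗ Sinv) f - curvOp φ τ η U f‖ ≤ βK * ‖f‖)
    (dR : ∀ s, ‖(SS ∘ₗ RofUk L m n φ η U (c₀ := c₀) ∘ₗ SSinv) s - RofUk L m n φ η U (c₀ := c₀) s‖ ≤ ρ * ‖s‖)
    (hP : ∀ f, ‖covDivL2K ℂ c₀ ((η : ℂ))⁻¹ (adTransportW φ fun b => (U b)⁻¹) f -
      RofUk L m n φ η U (c₀ := c₀) (covDivL2K ℂ c₀ ((η : ℂ))⁻¹ (adTransportW φ fun b => (U b)⁻¹) f)‖ ≤ CP * ‖f‖)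
    (small : pK / 2 + (21 + 3 * a) * β ^ 2 + 4 * β * CP + 2 * ρ * CP ^ 2 + βK ≤ γ / 4) (v : BondL2K ℂ d (towerP L m (n + 1)) c₀ W) :
    ‖(S ∘ₗ G1k L m n φ η U hL α hα1 hU1 hreg τ (c₀ := c₀) (c₁ := c₁) hpos ∘ₗ Sinv) v‖ ≤ 4 / γ * ‖v‖ := by
  -- transporter bounds `M_T = M_φM_φ′` for `R(U)` and `R(U⁻¹)`
  have hR : ∀ (b : Bond d (towerP L m (n + 1))) (w : W), ‖adTransportW φ U b w‖ ≤ Mφ * Mφ' * ‖w‖ :=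
    fun b w => norm_adTransportW_le φ hφ hφ' hMφ' U b (hU b) w
  have hSad : ∀ (b : Bond d (towerP L m (n + 1))) (w : W), ‖adTransportW φ (fun b => (U b)⁻¹) b w‖ ≤ Mφ * Mφ' * ‖w‖ :=
    fun b w => norm_adTransportW_le φ hφ hφ' hMφ' (fun b => (U b)⁻¹) b ((U1 𝔸).inv_mem (hU b)) w
  have hMT : 0 ≤ Mφ * Mφ' := mul_nonneg hMφ hMφ'
  have hθ : 0 ≤ ℓ * η := mul_nonneg hℓ hη.le
  have hwin' : ‖κ‖ * (ℓ * η) ≤ 1 := by simpa [mul_assoc] using hwin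
  have hcθ : ‖((η : ℂ))⁻¹‖ * (ℓ * η) = ℓ := by
    rw [norm_inv, Complex.norm_real, Real.norm_eq_abs, abs_of_pos hη]; field_simp
  -- adjoints of the two first-order letters
  have h1 : LinearMap.adjoint (covCurlL2K ℂ c₀ ((η : ℂ))⁻¹ (adTransportW φ U)) =
      covCoCurlL2K ℂ c₀ ((η : ℂ))⁻¹ (adTransportW φ fun b => (U b)⁻¹) := adjoint_covCurlL2K _ (conj_inv_eta' η) _ _ hRS
  have h2 : LinearMap.adjoint (covDivL2K ℂ c₀ ((η : ℂ))⁻¹ (adTransportW φ fun b => (U b)⁻¹)) =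
      covDerivL2K ℂ c₀ ((η : ℂ))⁻¹ (adTransportW φ U) := by
    rw [← adjoint_covDerivL2K ((η : ℂ))⁻¹ (conj_inv_eta' η) _ _ hRS, LinearMap.adjoint_adjoint]
  -- the four discharged letters
  have dB₁ : ∀ f, ‖(SP ∘ₗ covCurlL2K ℂ c₀ ((η : ℂ))⁻¹ (adTransportW φ U) ∘ₗ Sinv) f - covCurlL2K ℂ c₀ ((η : ℂ))⁻¹ (adTransportW φ U) f‖ ≤ β * ‖f‖ := by
    intro f
    have h := norm_mulOp_covCurlL2K_sub_le hθ hMT hR hχ hwin' ((η : ℂ))⁻¹ SP hSP Sinv hSinv f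
    simp only [LinearMap.comp_apply]
    refine h.trans ?_
    calc 4 * ‖((η : ℂ))⁻¹‖ * ‖κ‖ * (ℓ * η) * (Mφ * Mφ') * d * ‖f‖ = 4 * ‖κ‖ * ℓ * (Mφ * Mφ') * d * ‖f‖ := by
          rw [show 4 * ‖((η : ℂ))⁻¹‖ * ‖κ‖ * (ℓ * η) = 4 * ‖κ‖ * (‖((η : ℂ))⁻¹‖ * (ℓ * η)) by ring, hcθ]
      _ ≤ β * ‖f‖ := mul_le_mul_of_nonneg_right hβC (norm_nonneg _)
  have dB₁' : ∀ p, ‖(S ∘ₗ covCoCurlL2K ℂ c₀ ((η : ℂ))⁻¹ (adTransportW φ fun b => (U b)⁻¹) ∘ₗ SPinv) p -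
      LinearMap.adjoint (covCurlL2K ℂ c₀ ((η : ℂ))⁻¹ (adTransportW φ U)) p‖ ≤ β * ‖p‖ := by
    intro p
    rw [h1]
    have h := norm_mulOp_covCoCurlL2K_sub_le hθ hMT hSad hχ hwin' ((η : ℂ))⁻¹ S hS SPinv hSPinv p
    simp only [LinearMap.comp_apply]
    refine h.trans ?_
    calc 4 * ‖((η : ℂ))⁻¹‖ * ‖κ‖ * (ℓ * η) * (Mφ * Mφ') * (d * Real.sqrt d) * ‖p‖ = 4 * ‖κ‖ * ℓ * (Mφ * Mφ') * (d * Real.sqrt d) * ‖p‖ := by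
          rw [show 4 * ‖((η : ℂ))⁻¹‖ * ‖κ‖ * (ℓ * η) = 4 * ‖κ‖ * (‖((η : ℂ))⁻¹‖ * (ℓ * η)) by ring, hcθ]
      _ ≤ β * ‖p‖ := mul_le_mul_of_nonneg_right hβCC (norm_nonneg _)
  have dB₂ : ∀ f, ‖(SS ∘ₗ covDivL2K ℂ c₀ ((η : ℂ))⁻¹ (adTransportW φ fun b => (U b)⁻¹) ∘ₗ Sinv) f -
      covDivL2K ℂ c₀ ((η : ℂ))⁻¹ (adTransportW φ fun b => (U b)⁻¹) f‖ ≤ β * ‖f‖ := by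
    intro f
    have h := norm_mulOp_covDivL2K_sub_le hθ hMT hSad hχ hwin' ((η : ℂ))⁻¹ SS hSS Sinv hSinv f
    simp only [LinearMap.comp_apply]
    refine h.trans ?_
    calc 2 * ‖((η : ℂ))⁻¹‖ * ‖κ‖ * (ℓ * η) * (Mφ * Mφ') * Real.sqrt d * ‖f‖ = 2 * ‖κ‖ * ℓ * (Mφ * Mφ') * Real.sqrt d * ‖f‖ := by
          rw [show 2 * ‖((η : ℂ))⁻¹‖ * ‖κ‖ * (ℓ * η) = 2 * ‖κ‖ * (‖((η : ℂ))⁻¹‖ * (ℓ * η)) by ring, hcθ]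
      _ ≤ β * ‖f‖ := mul_le_mul_of_nonneg_right hβD (norm_nonneg _)
  have dB₂' : ∀ s, ‖(S ∘ₗ covDerivL2K ℂ c₀ ((η : ℂ))⁻¹ (adTransportW φ U) ∘ₗ SSinv) s -
      LinearMap.adjoint (covDivL2K ℂ c₀ ((η : ℂ))⁻¹ (adTransportW φ fun b => (U b)⁻¹)) s‖ ≤ β * ‖s‖ := by
    intro s
    rw [h2]
    have h := norm_mulOp_covDerivL2K_adTransportW_sub_le φ hφ hφ' hMφ hMφ' hη hℓ U hU hχ hwin S hS SSinv hSSinv s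
    simp only [LinearMap.comp_apply]
    exact h.trans (mul_le_mul_of_nonneg_right hβD (norm_nonneg _))
  -- the projection facts, the structure, the conjugated structure, the inverse
  have hRsq := re_inner_RofUk_eq L m n φ (η := η) (c₀ := c₀) U
  have hR1 := norm_RofUk_le L m n φ (η := η) (c₀ := c₀) U
  have hH := deltaAk_structure L m n φ (c₀ := c₀) (c₁ := c₁) (η := η) U hRS τ hL α hα1 hU1 hreg a
  have hHk := conjDeltaAk_apply L m n φ (η := η) U hRS τ hL α hα1 hU1 hreg a (κ := κ) (χ := χ) (S := S) (Sinv := Sinv) hSP hSPinv hSS hSSinv Qk Qk' hQfac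
  have hHkGk := conjDeltaAk_conjInv L m n φ U τ hL α hα1 hU1 hreg a (κ := κ) (χ := χ) hS hSinv hpos
  exact norm_Gk_le_projected (covCurlL2K ℂ c₀ ((η : ℂ))⁻¹ (adTransportW φ U)) (covDivL2K ℂ c₀ ((η : ℂ))⁻¹ (adTransportW φ fun b => (U b)⁻¹))
    (RofUk L m n φ η U (c₀ := c₀)) (QkW L m n φ U hL α hα1 hU1 hreg (c₀ := c₀) (c₁ := c₁)) (curvOp φ τ η U) (laplaceAk L m n φ η U hL α hα1 hU1 hreg τ (c₀ := c₀) (c₁ := c₁) a) a γ β βK pK ρ CP _ _ _ _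
    (SS ∘ₗ RofUk L m n φ η U (c₀ := c₀) ∘ₗ SSinv) Qk Qk' (S ∘ₗ curvOp φ τ η U ∘ₗ Sinv) (S ∘ₗ laplaceAk L m n φ η U hL α hα1 hU1 hreg τ (c₀ := c₀) (c₁ := c₁) a ∘ₗ Sinv)
    (S ∘ₗ G1k L m n φ η U hL α hα1 hU1 hreg τ (c₀ := c₀) (c₁ := c₁) hpos ∘ₗ Sinv)
    ha hγ hβ hρ hCP hRsq hR1 hH hcoer hKre dB₁ dB₁' dB₂ dB₂' dR dQ dQ' dK small hHk hHkGk hρ8 hP v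

end Instance

end Literature.MathematicalPhysics.QuantumFieldTheory.Balaban1983to89.B9Eq326ConjugatedDeltaATower

end
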